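import Summits.HodgeConjecture.HodgeConjecture.Theorems.F0P3cStCharTSEPPseudoCoeffSt   -- FILE A (this seat): §1–§5 `isPseudoCoeff_detG_of_ep`, `isPseudoCoeff_stG_of_ep`, `epSt_one_re_pos_im_zero`, `char_detG_eq_of_pin`, plumbing
import HarnessLib

/-!
# F0 · P3c · line LH6 «StCharTS» — CENSUS «EP-G» (G5) «DET-CHAR + PC-ST», FILE B: the LETTERS — K1 at `ψ∘det_G`, K1 ∧ POS-ONE at `St_G(ψ)` from ONE Euler–Poincaré function,
# and K2′ at `St_G(ψ)` (`⟨χ_St, χ_St⟩_e = 1`) from the elliptic Weyl mass [Rogawski1990 §12.6 p. 187, Prop. 12.6.1 (a) p. 188; Kottwitz1988 §2]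

Continuation of FILE A `F0P3cStCharTSEPPseudoCoeffSt` (same seat F0P3-p02 (g25), same pre-deal by F0P3a-p09 (g13), LEAD T15-05 (w2)); split only for the 400-line rule.  THEOREMS ONLY
(no `def`, no instance, no notation, no named fact, no `sorry`); `𝔇` a BINDER; the Euler–Poincaré function enters BY SHAPE as `hEP` = the conclusion of (G3)
`F0P3cStCharTSEPGlueG.exists_epFunction_G` VERBATIM, and the elliptic Weyl mass BY SHAPE as `hMass` = the conclusion of ★ (G4) `F0P3cStCharTSEllMassG.ellipticWeylMass_G_eq_one_of_epFunction`.
HONEST LABEL: count-neutral until RIDER 2 «EP-SPLIT» is priced (it re-letters the (S-𝔑) block's K1 ∕ K2′ ∕ POS-ONE to their non-EP instances, these being the dischargers);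
h413 OPEN; HC_CM is proved only modulo the 7 printed citations (2 remaining named inputs hLiu418 = stmt-HodgeConjecture-24832, h413 = stmt-HodgeConjecture-24833) until rung 0 closes.

* §6 **`exists_isPseudoCoeff_detG_of_epFunction`**, **`exists_isPseudoCoeff_stG_of_epFunction`** (K1 at `ψ∘det_G`; K1 ∧ POS-ONE at `St_G(ψ)`).
* §7 **`innerG_char_stG_self_eq_one_of_mass`** — K2′ at `St_G(ψ)`: `⟨χ_St, χ_St⟩_e = ⟨χ_det, χ_det⟩_e` (★ 61A-OF-NORMS `innerG_self_eq_of_eq_neg_on_ellG` under `hOpp`) `= Σ_T |Ω_T|⁻¹ ∫_T D_G² |ψ∘det_Z|²`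
  (FILE A §2 + unitarity of `ψ`, FILE A §1∕§1b) `= 1` (`hMass`).

## References
* [Rogawski1990] J. D. Rogawski, *Automorphic Representations of Unitary Groups in Three Variables*, Ann. of Math. Stud. 123 (1990): §12.2 (1) p. 173, §12.5 p. 184, §12.6 p. 187,
  Prop. 12.6.1 (a)(c) p. 188, pp. 194–195.
* [Kottwitz1988] R. E. Kottwitz, *Tamagawa numbers*, Ann. of Math. 127 (1988), §2 Theorem 2.
* [Serre1971] J.-P. Serre, *Cohomologie des groupes discrets*, Ann. of Math. Stud. 70 (1971), §3.3.
-/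

set_option autoImplicit false
-- the mandated namespace has the single-problem summit's repeated segment (`HodgeConjecture.HodgeConjecture`)
set_option linter.dupNamespace false

noncomputable section

open NumberField IsDedekindDomain MeasureTheory MeasureTheory.Measure Filter Topology Set
open scoped Matrix MatrixGroups ComplexConjugate
open Literature.NumberTheory.Rogawski1990 Literature.NumberTheory.Rogawski1990.Ch12Sec5
open Literature.NumberTheory.Automorphic Literature.NumberTheory.Automorphic.UnitaryGroup Literature.MeasureTheory.Group

namespace Summit.HodgeConjecture.HodgeConjecture.Cruxes.H413.F0P3cStCharTSEPPseudoCoeffStLetters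

open Summit.HodgeConjecture.HodgeConjecture.Cruxes.H413
open Summit.HodgeConjecture.HodgeConjecture.Cruxes.H413.F0P3cStCharTSEPPseudoCoeffSt
open Summit.HodgeConjecture.HodgeConjecture.Cruxes.H413.F0P3cStCharTSTorusDefs

section Datum

variable (L : Type) [Field L] [NumberField L] [IsCMField L] (v : HeightOneSpectrum (𝓞 ↥(maximalRealSubfield L)))

/-! ## §6 The K1 ∕ POS-ONE letters at `ψ∘det_G` and `St_G(ψ)` from ONE Euler–Poincaré function (the conclusion of (G3) `exists_epFunction_G` by shape) -/

/-- **K1 AT `ψ∘det_G` FROM (G3)**: given an Euler–Poincaré function (the conclusion of (G3) `F0P3cStCharTSEPGlueG.exists_epFunction_G` VERBATIM as `hEP`), `𝔇.detG ψ` has a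
pseudo-coefficient. [cite: Rogawski1990, §12.6 p. 187] [cite: Kottwitz1988, §2 Theorem 2] -/
theorem exists_isPseudoCoeff_detG_of_epFunction
    (hns : ∀ w : PlacesOver L v, IsCMField.complexConj L • w.1 = w.1)
    [MeasurableSpace (Gqs L v)] [BorelSpace (Gqs L v)]
    [∀ γ : Gqs L v, MeasurableSpace (Gqs L v ⧸ Subgroup.centralizer ({γ} : Set (Gqs L v)))]
    [MeasurableSpace (Gqs L v ⧸ Subgroup.center (Gqs L v))]
    {H : Type} [Group H] [TopologicalSpace H] [IsTopologicalGroup H] [MeasurableSpace H]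
    (νQv : Measure (Gqs L v)) [νQv.IsHaarMeasure]
    (mQv : OrbitalMeasureFamily (Gqs L v))
    (𝔇 : EllipticData (Gqs L v) H)
    (hμG : 𝔇.μG = νQv) (horb : 𝔇.orb = mQv)
    (hreg : ∀ γ : Gqs L v, γ ∈ 𝔇.regG ↔ IsRegularElt (γ.val : GL (Fin 3) (UnitaryGroup.LocalRing L v)))
    (hE : ∀ γ : Gqs L v, γ ∈ 𝔇.ellG ↔ IsRegularElt (γ.val : GL (Fin 3) (UnitaryGroup.LocalRing L v)) ∧ γ ∉ hyperbolicSet L v)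
    (hM1 : ∀ π : IrrClass (Gqs L v), Measurable (𝔇.char π) ∧ LocallyIntegrable (𝔇.char π) 𝔇.μG ∧
      (∀ x ∈ 𝔇.regG, ∀ᶠ y in 𝓝 x, 𝔇.char π y = 𝔇.char π x) ∧
      ∀ φ : Gqs L v → ℂ, IsLocSmooth φ → π.smoothTrace 𝔇.μG φ = ∫ x, φ x * 𝔇.char π x ∂𝔇.μG)
    (hEP : ∃ fG : Gqs L v → ℂ, IsLocSmooth fG ∧ Measurable fG ∧ Integrable fG νQv ∧ ∫ g, fG g ∂νQv = 1 ∧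
      (fG 1).im = 0 ∧ (fG 1).re < 0 ∧
      (∀ γ : Gqs L v, IsRegularElt (γ.val : GL (Fin 3) (UnitaryGroup.LocalRing L v)) →
        IsCompact ((Subgroup.centralizer ({γ} : Set (Gqs L v))) : Set (Gqs L v)) → classOrbitalIntegral mQv fG (ConjClasses.mk γ) = 1) ∧
      (∀ γ : Gqs L v, IsRegularElt (γ.val : GL (Fin 3) (UnitaryGroup.LocalRing L v)) →
        ¬ IsCompact ((Subgroup.centralizer ({γ} : Set (Gqs L v))) : Set (Gqs L v)) → classOrbitalIntegral mQv fG (ConjClasses.mk γ) = 0))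
    (ψ : ↥(Subgroup.center (Gqs L v)) →* ℂˣ) (detZ : Gqs L v →* ↥(Subgroup.center (Gqs L v)))
    (hopen : IsOpen (((ψ.comp detZ).ker : Subgroup (Gqs L v)) : Set (Gqs L v)))
    (hdet : 𝔇.detG ψ = IrrClass.mk (SmoothIrrep.ofChar (ψ.comp detZ) hopen)) :
    ∃ f : Gqs L v → ℂ, 𝔇.IsPseudoCoeff (𝔇.detG ψ) f := by
  obtain ⟨fG, hfG, -, -, -, -, -, h1, h0⟩ := hEP
  exact ⟨_, isPseudoCoeff_detG_of_ep L v hns νQv mQv 𝔇 hμG horb hreg hE hM1 detZ hopen hdet hfG h1 h0⟩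

/-- **K1 ∧ POS-ONE AT `St_G(ψ)` FROM (G3)**: given an Euler–Poincaré function (`hEP` = the conclusion of (G3) VERBATIM) and the opposite-character relation `hOpp` (★ OPP-23 at the
kind-2 pair), `St_G(ψ)` has a pseudo-coefficient `f` with `f(1)` a POSITIVE real — the `St_G(ψ)` instances of the (S-𝔑) letters K1 `PseudoCoeffExists` and POS-ONE.
[cite: Rogawski1990, §12.6 p. 187; pp. 194–195; Prop. 12.6.1 (c) p. 188] [cite: Kottwitz1988, §2 Theorem 2] [cite: Serre1971, §3.3] -/
theorem exists_isPseudoCoeff_stG_of_epFunction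
    (hns : ∀ w : PlacesOver L v, IsCMField.complexConj L • w.1 = w.1)
    [MeasurableSpace (Gqs L v)] [BorelSpace (Gqs L v)]
    [∀ γ : Gqs L v, MeasurableSpace (Gqs L v ⧸ Subgroup.centralizer ({γ} : Set (Gqs L v)))]
    [MeasurableSpace (Gqs L v ⧸ Subgroup.center (Gqs L v))]
    {H : Type} [Group H] [TopologicalSpace H] [IsTopologicalGroup H] [MeasurableSpace H]
    (νQv : Measure (Gqs L v)) [νQv.IsHaarMeasure]
    (mQv : OrbitalMeasureFamily (Gqs L v))
    (𝔇 : EllipticData (Gqs L v) H)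
    (hμG : 𝔇.μG = νQv) (horb : 𝔇.orb = mQv)
    (hreg : ∀ γ : Gqs L v, γ ∈ 𝔇.regG ↔ IsRegularElt (γ.val : GL (Fin 3) (UnitaryGroup.LocalRing L v)))
    (hE : ∀ γ : Gqs L v, γ ∈ 𝔇.ellG ↔ IsRegularElt (γ.val : GL (Fin 3) (UnitaryGroup.LocalRing L v)) ∧ γ ∉ hyperbolicSet L v)
    (hM1 : ∀ π : IrrClass (Gqs L v), Measurable (𝔇.char π) ∧ LocallyIntegrable (𝔇.char π) 𝔇.μG ∧
      (∀ x ∈ 𝔇.regG, ∀ᶠ y in 𝓝 x, 𝔇.char π y = 𝔇.char π x) ∧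
      ∀ φ : Gqs L v → ℂ, IsLocSmooth φ → π.smoothTrace 𝔇.μG φ = ∫ x, φ x * 𝔇.char π x ∂𝔇.μG)
    (hEP : ∃ fG : Gqs L v → ℂ, IsLocSmooth fG ∧ Measurable fG ∧ Integrable fG νQv ∧ ∫ g, fG g ∂νQv = 1 ∧
      (fG 1).im = 0 ∧ (fG 1).re < 0 ∧
      (∀ γ : Gqs L v, IsRegularElt (γ.val : GL (Fin 3) (UnitaryGroup.LocalRing L v)) →
        IsCompact ((Subgroup.centralizer ({γ} : Set (Gqs L v))) : Set (Gqs L v)) → classOrbitalIntegral mQv fG (ConjClasses.mk γ) = 1) ∧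
      (∀ γ : Gqs L v, IsRegularElt (γ.val : GL (Fin 3) (UnitaryGroup.LocalRing L v)) →
        ¬ IsCompact ((Subgroup.centralizer ({γ} : Set (Gqs L v))) : Set (Gqs L v)) → classOrbitalIntegral mQv fG (ConjClasses.mk γ) = 0))
    (ψ : ↥(Subgroup.center (Gqs L v)) →* ℂˣ) (detZ : Gqs L v →* ↥(Subgroup.center (Gqs L v)))
    (hopen : IsOpen (((ψ.comp detZ).ker : Subgroup (Gqs L v)) : Set (Gqs L v)))
    (hdet : 𝔇.detG ψ = IrrClass.mk (SmoothIrrep.ofChar (ψ.comp detZ) hopen))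
    (hOpp : ∀ γ ∈ 𝔇.ellG, 𝔇.char (𝔇.stG ψ) γ = -𝔇.char (𝔇.detG ψ) γ) :
    ∃ f : Gqs L v → ℂ, 𝔇.IsPseudoCoeff (𝔇.stG ψ) f ∧ 0 < (f 1).re ∧ (f 1).im = 0 := by
  obtain ⟨fG, hfG, -, -, -, him, hre, h1, h0⟩ := hEP
  exact ⟨_, isPseudoCoeff_stG_of_ep L v hns νQv mQv 𝔇 hμG horb hreg hE hM1 detZ hopen hdet hOpp hfG h1 h0,
    (epSt_one_re_pos_im_zero ψ detZ him hre).1, (epSt_one_re_pos_im_zero ψ detZ him hre).2⟩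

/-! ## §7 K2′ at `St_G(ψ)`: `⟨χ_{St_G(ψ)}, χ_{St_G(ψ)}⟩_e = 1` from the elliptic Weyl mass (★ (G4)) -/

/-- **K2′ AT `St_G(ψ)`: `⟨χ_{St_G(ψ)}, χ_{St_G(ψ)}⟩_e = 1`** at a §12.5 datum on `U(Φ₃)(L⁺_v)` (`v` non-split), from: (C2) `hC2 : EllCartanAE`; the opposite-character relation `hOpp`
(★ OPP-23 at the kind-2 pair); the DET pin read through (M1∀) (§2: `χ_{ψ∘det_G} = ψ∘det_Z` on `G^r ⊇ G^e`, `hE`∕`hreg`); the UNITARITY of the continuous character `ψ` of the COMPACT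
centre (★ `isCompact_center_Gqs`, §1 `norm_centerChar_eq_one`); and the ELLIPTIC WEYL MASS `Σ_T |Ω_T|⁻¹ ∫_T D_G² = 1` — the conclusion of ★ (G4) `F0P3cStCharTSEllMassG.ellipticWeylMass_G_eq_one_of_epFunction`
taken BY SHAPE as `hMass`.  Route: `⟨χ_St, χ_St⟩_e = ⟨χ_det, χ_det⟩_e` (★ 61A-OF-NORMS `innerG_self_eq_of_eq_neg_on_ellG`) `= Σ_T |Ω_T|⁻¹ ∫_T D_G² |ψ∘det_Z|²` (§1b) `= 1`.
This is the `St_G(ψ)` instance of the (S-𝔑) letter K2′ `hL2one` [Rogawski1990, Prop. 12.6.1 (a) p. 188, «`π′ = St_G(ψ)` and `χ_{π′}(f_{π′}) = 1`»], here via Kottwitz's Euler–Poincaré function.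
[cite: Rogawski1990, §12.6 Prop. 12.6.1 (a) p. 188; §12.5 p. 184; §12.2 (1) p. 173] [cite: Kottwitz1988, §2 Theorem 2] -/
theorem innerG_char_stG_self_eq_one_of_mass
    (hns : ∀ w : PlacesOver L v, IsCMField.complexConj L • w.1 = w.1)
    [MeasurableSpace (Gqs L v)] [BorelSpace (Gqs L v)]
    [∀ γ : Gqs L v, MeasurableSpace (Gqs L v ⧸ Subgroup.centralizer ({γ} : Set (Gqs L v)))]
    [MeasurableSpace (Gqs L v ⧸ Subgroup.center (Gqs L v))]
    {H : Type} [Group H] [TopologicalSpace H] [IsTopologicalGroup H] [MeasurableSpace H]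
    (νQv : Measure (Gqs L v)) [νQv.IsHaarMeasure]
    (𝔇 : EllipticData (Gqs L v) H)
    (hμG : 𝔇.μG = νQv)
    (hreg : ∀ γ : Gqs L v, γ ∈ 𝔇.regG ↔ IsRegularElt (γ.val : GL (Fin 3) (UnitaryGroup.LocalRing L v)))
    (hE : ∀ γ : Gqs L v, γ ∈ 𝔇.ellG ↔ IsRegularElt (γ.val : GL (Fin 3) (UnitaryGroup.LocalRing L v)) ∧ γ ∉ hyperbolicSet L v)
    (hM1 : ∀ π : IrrClass (Gqs L v), Measurable (𝔇.char π) ∧ LocallyIntegrable (𝔇.char π) 𝔇.μG ∧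
      (∀ x ∈ 𝔇.regG, ∀ᶠ y in 𝓝 x, 𝔇.char π y = 𝔇.char π x) ∧
      ∀ φ : Gqs L v → ℂ, IsLocSmooth φ → π.smoothTrace 𝔇.μG φ = ∫ x, φ x * 𝔇.char π x ∂𝔇.μG)
    (hC2 : 𝔇.EllCartanAE)
    (hMass : ∑ T ∈ 𝔇.cartanG, ((weylOrder T : ℂ))⁻¹ * ∫ t : ↥T, ((𝔇.DG (t : Gqs L v) : ℂ)) ^ 2 ∂(𝔇.μT T) = 1)
    {ψ : ↥(Subgroup.center (Gqs L v)) →* ℂˣ} (hψ : Continuous ψ) (detZ : Gqs L v →* ↥(Subgroup.center (Gqs L v)))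
    (hopen : IsOpen (((ψ.comp detZ).ker : Subgroup (Gqs L v)) : Set (Gqs L v)))
    (hdet : 𝔇.detG ψ = IrrClass.mk (SmoothIrrep.ofChar (ψ.comp detZ) hopen))
    (hOpp : ∀ γ ∈ 𝔇.ellG, 𝔇.char (𝔇.stG ψ) γ = -𝔇.char (𝔇.detG ψ) γ) :
    𝔇.innerG (𝔇.char (𝔇.stG ψ)) (𝔇.char (𝔇.stG ψ)) = 1 := by
  -- `ψ` is unitary: the centre is compact
  haveI : CompactSpace ↥(Subgroup.center (Gqs L v)) := isCompact_iff_compactSpace.1 (F0P3cStCharTSParField.isCompact_center_Gqs L v hns)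
  have hψ1 : ∀ z : ↥(Subgroup.center (Gqs L v)), ‖((ψ z : ℂˣ) : ℂ)‖ = 1 :=
    norm_centerChar_eq_one ψ (Units.continuous_val.comp hψ)
  -- `⟨χ_St, χ_St⟩_e = ⟨χ_det, χ_det⟩_e`
  rw [F0P3cStCharTSProp1261aOfNorms.innerG_self_eq_of_eq_neg_on_ellG 𝔇 hC2 hOpp]
  -- `χ_det · conj χ_det = |ψ∘det_Z|² = 1` a.e. on every elliptic torus
  have hchar := char_detG_eq_of_pin L v νQv 𝔇 hμG hM1 detZ hopen hdet
  rw [innerG_self_eq_ellipticWeylMass_of_mul_conj_eq_one 𝔇 fun T hT => (hC2 T hT).mono fun t ht => ?_, hMass]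
  have hreg' : (t : Gqs L v) ∈ 𝔇.regG := (hreg _).2 ((hE _).1 ht).1
  rw [hchar _ hreg', Complex.mul_conj, Complex.normSq_eq_norm_sq, hψ1, one_pow, Complex.ofReal_one]

end Datum

end Summit.HodgeConjecture.HodgeConjecture.Cruxes.H413.F0P3cStCharTSEPPseudoCoeffStLetters

end
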